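import Summits.BirchSwinnertonDyer.BirchSwinnertonDyer.Theorems.ErratumRoadFiveNonSurjCornerKolyJLevelTransport
import Summits.BirchSwinnertonDyer.BirchSwinnertonDyer.Theorems.ClassRecordThreeEulerHalvesAtThreeWalkSupplyTransverse
import Summits.BirchSwinnertonDyer.Rank1Residual.X11b.TorsionLevelCohomology
import HarnessLib

/-!
# The TRANSVERSE local condition is CARTESIAN under the change of level `ι_* : H¹(K, E[d]) → H¹(K, E[n])` at a place
# whose decomposition group fixes `E[n]` — the compatibility `ι_*⁻¹ 𝒯_{n,v} = 𝒯_{d,v}` of the swap supply's transverse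
# structures (cell `bsd-stepL`, seat `bsd-stepL-corner-p1` g9; `--supports stmt-BirchSwinnertonDyer-19947`)

WHAT. The swap supply of `stub_kolyJ_max` (`…KolyJSwapInputs`, `…KolyJLevelOneSupply`) asks, per family, for the Selmer
membership of the level-`p` avatars `κ̄_s` in `𝓕_p(s) = selmerF W p 𝒯₁ (placesDividing K s)`; by `…KolyJLevelOneAvatar`
`ι_* κ̄_s = c_{M+1}(s)`, and `…KolyJLevelTransport` (p517266 ∕ p517808) transports the SIGN and the KUMMER places along
`ι_*`. This file transports the TRANSVERSE places, for the tree's intrinsic transverse condition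
`H¹_tr(K_v, E[m]) = ker(H¹(K_v, E[m]) → H¹(K[ℓ]_{w'}, E[m]))` (`transverseSubgroup`; the walk's GLOBAL family of
`Walk.exists_globalTransverseFamily`, tam3-p1): at a place `v` whose absolute Galois group fixes `E[n]` — every
place over a Kolyvagin prime of index `≥` the exponent of `n` (`absGaloisRestrict_smul_geomTorsion_eq_of_kolyvaginPrime_pow`)
— `loc_v x ∈ 𝒯_{d,v} ↔ loc_v (ι_* x) ∈ 𝒯_{n,v}` (`d ∣ n`).
* §1 `Levels.map_one_injective_of_forall_fixed` (any field): `H¹(i) : H¹(F, A) → H¹(F, B)` is INJECTIVE when `Γ_F` fixes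
  `B` pointwise (`i : A ↪ B ⊇ B[n]`, `n A = 0`): a kernel class is a connecting class `δ(b)`, and `b` itself is the
  invariant witness of `Levels.connectingClass_eq_zero_iff`.
* §2 `localization_map_mem_transverseSubgroup_iff` (any equivariant `f`, any `K_v`-field `L`): if `H¹(f|_{Γ_L})` is
  injective then `loc_v c` is `L`-transverse iff `loc_v (f_* c)` is (naturality `res_map_one` twice).
* §3 `localization_torsionH1OfDvd_mem_transverseSubgroup_iff`: the case `f = (E[d] ↪ E[n])`, `Γ_{K_v}` fixing `E[n]`.
* §4 `localization_torsionH1OfDvd_mem_globalTransverse_iff`: the same for the walk's global intrinsic families `𝒯_d`,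
  `𝒯_n` (an `iInf` over the primes `ℓ ∈ v` and the places `w' ∣ v` of `K[ℓ]`).
HONEST FRAMING: four small theorems; no definition ∕ fact ∕ sorry; nothing about any curve's arithmetic; no stub closes; T7.
References: [McCallumLMS1991] §4 Lemma 4.6 (the change of level on Kolyvagin classes), §3 (3); [MazurRubin2004] Def. 1.1.6
(transverse condition), Lemma 3.5.2-type cartesian property; [Jetchev2008] §3.1.2 (p. 814); [GrossLMS1991] Prop. 9.6
(`E(K_λ)_{p} = E_p` at a Kolyvagin prime).
-/

set_option autoImplicit false
set_option linter.dupNamespace false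

noncomputable section

open scoped Classical NumberField

/-! ### §1 Injectivity of `H¹(i)` when the Galois group acts trivially on the target -/

namespace Summit.BirchSwinnertonDyer.Rank1Residual.X11b.Levels

open Literature.NumberTheory.GaloisRepresentations Field
open scoped ContRepresentation

universe u

variable {F : Type u} [Field F] {A B : Type u} [AddCommGroup A] [TopologicalSpace A]
  [DiscreteTopology A] [AddCommGroup B] [TopologicalSpace B] [DiscreteTopology B]
  {ρA : DiscreteGaloisModule F A} {ρB : DiscreteGaloisModule F B}
  {i : ρA.toContRepresentation →ⁱL ρB.toContRepresentation} {n : ℕ}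

/-- **`Γ_F` trivial on `B` ⟹ `H¹(i) : H¹(F, A) → H¹(F, B)` is injective** (for `i : A ↪ B` with `range i ⊇ B[n]`,
`n A = 0`): a class killed by `H¹(i)` is a connecting class `δ(b)` (`map_one_eq_zero_iff_exists`), and `δ(b) = 0` as soon
as SOME invariant `b₀` has `n b₀ = n b` (`connectingClass_eq_zero_iff`) — here `b₀ = b`. (With trivial action
`H¹ = Hom_cont(Γ_F, ·)` and `H¹(i)` is post-composition with an injection.) The local situation at a Kolyvagin prime `λ`
of index `≥` the exponent of `B = E[n]`: `Γ_{K_λ}` fixes `E[n]` (Gross Prop. 9.6 ∕ McCallum §3 (3)).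
[cite: McCallumLMS1991, §3 (3), §4 Lemma 4.6] [cite: GrossLMS1991, Prop. 9.6] -/
theorem map_one_injective_of_forall_fixed
    (hrange : ∀ b : B, n • b = 0 → ∃ a : A, i a = b) (hinj : Function.Injective i)
    (hA : ∀ a : A, n • a = 0) (hΓ : ∀ (σ : absoluteGaloisGroup F) (b : B), ρB σ b = b) :
    Function.Injective (galoisCohomology.map i 1) := by
  rw [injective_iff_map_eq_zero]
  intro c hc
  obtain ⟨b, hb, rfl⟩ := (map_one_eq_zero_iff_exists (hrange := hrange) hinj hA c).mp hc
  rw [connectingClass_eq_zero_iff hinj hA]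
  exact ⟨b, fun σ ↦ hΓ σ b, rfl⟩

end Summit.BirchSwinnertonDyer.Rank1Residual.X11b.Levels

namespace Summit.BirchSwinnertonDyer.BirchSwinnertonDyer.Theorems

open WeierstrassCurve NumberField IsDedekindDomain Field
  Literature.NumberTheory.EllipticCurves Literature.NumberTheory.GaloisRepresentations
  Literature.NumberTheory.GaloisRepresentations.DiscreteGaloisModule
  Literature.NumberTheory.Automorphic
open scoped ContRepresentation

universe u

/-! ### §2 Transverse membership of a localisation under an equivariant change of coefficients -/

section Equivariant

variable {K : Type u} [Field K] [NumberField K] {M : Type u} [AddCommGroup M] [TopologicalSpace M]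
  [DiscreteTopology M] {M' : Type u} [AddCommGroup M'] [TopologicalSpace M'] [DiscreteTopology M']
  {ρ : DiscreteGaloisModule K M} {ρ' : DiscreteGaloisModule K M'}

/-- **`y` is `L`-transverse iff `g_* y` is**, for an equivariant `g : M → M'` of discrete Galois modules over a field
`F` whose `H¹` over `Γ_L` is injective (`L` any `F`-field): naturality `res_L (g_* y) = (g|_{Γ_L})_* (res_L y)`
(`res_map_one`). [cite: MazurRubin2004, Def. 1.1.6] [cite: Rubin2011, Def. 1.9.4 (p. 14)] -/
theorem mem_transverseSubgroup_iff_map_mem {F : Type u} [Field F] {M₁ : Type u} [AddCommGroup M₁]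
    [TopologicalSpace M₁] [DiscreteTopology M₁] {M₂ : Type u} [AddCommGroup M₂] [TopologicalSpace M₂]
    [DiscreteTopology M₂] {ρ₁ : DiscreteGaloisModule F M₁} {ρ₂ : DiscreteGaloisModule F M₂}
    (g : ρ₁.toContRepresentation →ⁱL ρ₂.toContRepresentation) (L : Type u) [Field L] [Algebra F L]
    (hinj : Function.Injective (galoisCohomology.map (g.restrictField L) 1)) (y : galoisCohomology ρ₁ 1) :
    y ∈ transverseSubgroup ρ₁ L ↔ galoisCohomology.map g 1 y ∈ transverseSubgroup ρ₂ L := by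
  rw [mem_transverseSubgroup_iff, mem_transverseSubgroup_iff, galoisCohomology.res_map_one]
  exact ⟨fun h ↦ by rw [h, map_zero], fun h ↦ hinj (by rw [h, map_zero])⟩

/-- **`loc_v c` is `L`-transverse iff `loc_v (f_* c)` is**, for an equivariant `f : M → M'` over the number field `K`
whose `H¹` over `Γ_L` is injective (`L` any `K_v`-field): `loc_v (f_* c) = (f|_{Γ_{K_v}})_* (loc_v c)` (`res_map_one`
over `K`) and `mem_transverseSubgroup_iff_map_mem` over `K_v`. [cite: MazurRubin2004, Def. 1.1.6]
[cite: Jetchev2008, §3.1.2 (p. 814)] -/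
theorem localization_map_mem_transverseSubgroup_iff (f : ρ.toContRepresentation →ⁱL ρ'.toContRepresentation)
    (v : HeightOneSpectrum (𝓞 K)) (L : Type u) [Field L] [Algebra (v.adicCompletion K) L]
    (hinj : Function.Injective
      (galoisCohomology.map ((f.restrictField (v.adicCompletion K)).restrictField L) 1))
    (c : galoisCohomology ρ 1) :
    galoisCohomology.localization ρ (Sum.inr v) 1 c ∈ transverseSubgroup (GaloisRep.toLocal v ρ) L ↔
      galoisCohomology.localization ρ' (Sum.inr v) 1 (galoisCohomology.map f 1 c) ∈
        transverseSubgroup (GaloisRep.toLocal v ρ') L := by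
  have hnat : galoisCohomology.localization ρ' (Sum.inr v) 1 (galoisCohomology.map f 1 c) =
      galoisCohomology.map (f.restrictField (v.adicCompletion K)) 1
        (galoisCohomology.localization ρ (Sum.inr v) 1 c) :=
    galoisCohomology.res_map_one (v.adicCompletion K) f c
  have h := mem_transverseSubgroup_iff_map_mem (ρ₁ := GaloisRep.toLocal v ρ) (ρ₂ := GaloisRep.toLocal v ρ')
    (f.restrictField (v.adicCompletion K)) L hinj (galoisCohomology.localization ρ (Sum.inr v) 1 c)
  exact h.trans (hnat ▸ Iff.rfl)

end Equivariant

/-! ### §3 The change of level `E[d] ↪ E[n]` at a place whose Galois group fixes `E[n]` -/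

section Levels

variable {K : Type u} [Field K] [NumberField K] (X : WeierstrassCurve K)

/-- **The transverse condition is CARTESIAN under `ι_*` at a place `v` with `Γ_{K_v}` fixing `E[n]`**: for `d ∣ n`
(`d ≠ 0`), any `K_v`-field `L` and `x ∈ H¹(K, E[d])`, `loc_v x ∈ ker(H¹(K_v, E[d]) → H¹(L, E[d]))` iff
`loc_v (ι_* x) ∈ ker(H¹(K_v, E[n]) → H¹(L, E[n]))`. By §2 with `f = (E[d] ↪ E[n])` (`torsionInclusion`,
`map_torsionInclusion_one_apply`), whose `H¹` over `Γ_L` is injective by §1: `Γ_L` acts through `Γ_{K_v}`, which fixes `E[n]`.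
[cite: McCallumLMS1991, §3 (3), §4 Lemma 4.6] [cite: GrossLMS1991, Prop. 9.6] [cite: MazurRubin2004, Def. 1.1.6] -/
theorem localization_torsionH1OfDvd_mem_transverseSubgroup_iff {d n : ℕ} (hdn : d ∣ n)
    (v : HeightOneSpectrum (𝓞 K))
    (htriv : ∀ (g : absoluteGaloisGroup (v.adicCompletion K)) (Q : geomTorsion X ((n : ℕ) : ℤ)),
      resGal (K := K) (v.adicCompletion K) g • Q = Q)
    (L : Type u) [Field L] [Algebra (v.adicCompletion K) L] (x : galH1Torsion X ((d : ℕ) : ℤ)) :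
    galoisCohomology.localization (X.torsionGaloisModule ((d : ℕ) : ℤ)) (Sum.inr v) 1 x ∈
        transverseSubgroup (GaloisRep.toLocal v (X.torsionGaloisModule ((d : ℕ) : ℤ))) L ↔
      galoisCohomology.localization (X.torsionGaloisModule ((n : ℕ) : ℤ)) (Sum.inr v) 1
          (torsionH1OfDvd X (Int.natCast_dvd_natCast.mpr hdn) x) ∈
        transverseSubgroup (GaloisRep.toLocal v (X.torsionGaloisModule ((n : ℕ) : ℤ))) L := by
  have hle := X.geomTorsion_le_of_dvd (Int.natCast_dvd_natCast.mpr hdn)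
  rw [← map_torsionInclusion_one_apply]
  refine localization_map_mem_transverseSubgroup_iff (X.torsionInclusion (Int.natCast_dvd_natCast.mpr hdn)) v L
    (Summit.BirchSwinnertonDyer.Rank1Residual.X11b.Levels.map_one_injective_of_forall_fixed
      (n := d) ?_ ?_ ?_ ?_) x
  · -- `range ι ⊇ E[n][d]`
    intro b hb
    have hb' : ((d : ℕ) : ℤ) • (b : geomPoints X) = 0 := by
      rw [natCast_zsmul, ← AddSubmonoidClass.coe_nsmul, hb, ZeroMemClass.coe_zero]
    exact ⟨⟨(b : geomPoints X), (mem_geomTorsion_iff _ _ _).2 hb'⟩, Subtype.ext rfl⟩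
  · -- `ι` injective
    intro a a' h
    exact Subtype.ext (congrArg (fun P : geomTorsion X ((n : ℕ) : ℤ) ↦ (P : geomPoints X)) h)
  · -- `d` kills `E[d]`
    intro a
    apply Subtype.ext
    rw [AddSubmonoidClass.coe_nsmul, ZeroMemClass.coe_zero, ← natCast_zsmul]
    exact (mem_geomTorsion_iff _ _ _).1 a.2
  · -- `Γ_L` fixes `E[n]` (it acts through `Γ_{K_v}`)
    intro σ b
    exact htriv (absGaloisRestrict (v.adicCompletion K) L σ) b

end Levels

/-! ### §4 The walk's global intrinsic transverse families at two levels -/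

section Global

/-- Membership in a double `iInf` of subgroups indexed by a predicate-guarded pair. [folklore] -/
theorem mem_iInf₂_iInf₂_iff {G : Type*} [AddGroup G] {α : Type*} {p : α → Prop} {κ : α → Type*}
    {q : ∀ a, κ a → Prop} (S : ∀ a (k : κ a), q a k → AddSubgroup G) (y : G) :
    y ∈ (⨅ (a : α) (_ : p a), ⨅ (k : κ a) (h : q a k), S a k h) ↔ ∀ a, p a → ∀ k (h : q a k), y ∈ S a k h := by
  simp only [AddSubgroup.mem_iInf]


variable {K : Type} [Field K] [NumberField K] (W : WeierstrassCurve ℚ) {ι : K →+* ℂ}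
  [∀ k : ℕ, NumberField (ringClassField K ι k)]

/-- **`ι_*⁻¹ 𝒯_{n,v} = 𝒯_{d,v}` for the walk's GLOBAL intrinsic transverse families** (tam3's
`Walk.exists_globalTransverseFamily` at the levels `d ∣ n`: `𝒯_v = ⨅_{ℓ ∈ v} ⨅_{w' ∣ v} ker(H¹(K_v, E[·]) →
H¹(K[ℓ]_{w'}, E[·]))`) at a finite place `v` whose absolute Galois group fixes `E[n]` — e.g. the place over a Kolyvagin
prime of index `≥` the exponent of `n` (`absGaloisRestrict_smul_geomTorsion_eq_of_kolyvaginPrime_pow`). So the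
transverse half of the swap supply's `hκSel` for the level-`p` avatar `κ̄_s` (`ι_* κ̄_s = c_{M+1}(s)`) READS as the
transverse membership of `c_{M+1}(s)` for the level-`p^{M+1}` family — the walk's currency. [cite: McCallumLMS1991, §4 Lemma 4.6]
[cite: Jetchev2008, §3.1.2 (p. 814), §3.4.1 (p. 816)] [cite: MazurRubin2004, Def. 1.1.6] -/
theorem localization_torsionH1OfDvd_mem_globalTransverse_iff {d n : ℕ} (hdn : d ∣ n)
    {𝒯d : SelmerStructure ((W.baseChange K).torsionGaloisModule ((d : ℕ) : ℤ))}
    (h𝒯d : ∀ v : HeightOneSpectrum (𝓞 K), 𝒯d (Sum.inr v) =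
      ⨅ (ℓ : ℕ) (_ : ℓ.Prime ∧ (ℓ : 𝓞 K) ∈ v.asIdeal),
        ⨅ (w' : HeightOneSpectrum (𝓞 (ringClassField K ι ℓ)))
          (_ : w'.asIdeal.LiesOver v.asIdeal),
          letI := (adicCompletionOfLiesOver K (ringClassField K ι ℓ) v w').toAlgebra
          transverseSubgroup (GaloisRep.toLocal v ((W.baseChange K).torsionGaloisModule ((d : ℕ) : ℤ)))
            (w'.adicCompletion (ringClassField K ι ℓ)))
    {𝒯n : SelmerStructure ((W.baseChange K).torsionGaloisModule ((n : ℕ) : ℤ))}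
    (h𝒯n : ∀ v : HeightOneSpectrum (𝓞 K), 𝒯n (Sum.inr v) =
      ⨅ (ℓ : ℕ) (_ : ℓ.Prime ∧ (ℓ : 𝓞 K) ∈ v.asIdeal),
        ⨅ (w' : HeightOneSpectrum (𝓞 (ringClassField K ι ℓ)))
          (_ : w'.asIdeal.LiesOver v.asIdeal),
          letI := (adicCompletionOfLiesOver K (ringClassField K ι ℓ) v w').toAlgebra
          transverseSubgroup (GaloisRep.toLocal v ((W.baseChange K).torsionGaloisModule ((n : ℕ) : ℤ)))
            (w'.adicCompletion (ringClassField K ι ℓ)))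
    (v : HeightOneSpectrum (𝓞 K))
    (htriv : ∀ (g : absoluteGaloisGroup (v.adicCompletion K))
      (Q : geomTorsion (W.baseChange K) ((n : ℕ) : ℤ)), resGal (K := K) (v.adicCompletion K) g • Q = Q)
    (x : galH1Torsion (W.baseChange K) ((d : ℕ) : ℤ)) :
    galoisCohomology.localization ((W.baseChange K).torsionGaloisModule ((d : ℕ) : ℤ)) (Sum.inr v) 1 x ∈
        𝒯d (Sum.inr v) ↔
      galoisCohomology.localization ((W.baseChange K).torsionGaloisModule ((n : ℕ) : ℤ)) (Sum.inr v) 1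
          (torsionH1OfDvd (W.baseChange K) (Int.natCast_dvd_natCast.mpr hdn) x) ∈ 𝒯n (Sum.inr v) := by
  rw [h𝒯d v, h𝒯n v]
  have hd_iff := mem_iInf₂_iInf₂_iff
    (G := galoisCohomology (GaloisRep.toLocal v ((W.baseChange K).torsionGaloisModule ((d : ℕ) : ℤ))) 1)
    (p := fun ℓ : ℕ ↦ ℓ.Prime ∧ (ℓ : 𝓞 K) ∈ v.asIdeal)
    (κ := fun ℓ : ℕ ↦ HeightOneSpectrum (𝓞 (ringClassField K ι ℓ)))
    (q := fun ℓ w' ↦ w'.asIdeal.LiesOver v.asIdeal)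
    (fun ℓ w' h ↦ haveI := h
      letI := (adicCompletionOfLiesOver K (ringClassField K ι ℓ) v w').toAlgebra
      transverseSubgroup (GaloisRep.toLocal v ((W.baseChange K).torsionGaloisModule ((d : ℕ) : ℤ)))
        (w'.adicCompletion (ringClassField K ι ℓ)))
    (galoisCohomology.localization ((W.baseChange K).torsionGaloisModule ((d : ℕ) : ℤ)) (Sum.inr v) 1 x)
  have hn_iff := mem_iInf₂_iInf₂_iff
    (G := galoisCohomology (GaloisRep.toLocal v ((W.baseChange K).torsionGaloisModule ((n : ℕ) : ℤ))) 1)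
    (p := fun ℓ : ℕ ↦ ℓ.Prime ∧ (ℓ : 𝓞 K) ∈ v.asIdeal)
    (κ := fun ℓ : ℕ ↦ HeightOneSpectrum (𝓞 (ringClassField K ι ℓ)))
    (q := fun ℓ w' ↦ w'.asIdeal.LiesOver v.asIdeal)
    (fun ℓ w' h ↦ haveI := h
      letI := (adicCompletionOfLiesOver K (ringClassField K ι ℓ) v w').toAlgebra
      transverseSubgroup (GaloisRep.toLocal v ((W.baseChange K).torsionGaloisModule ((n : ℕ) : ℤ)))
        (w'.adicCompletion (ringClassField K ι ℓ)))
    (galoisCohomology.localization ((W.baseChange K).torsionGaloisModule ((n : ℕ) : ℤ)) (Sum.inr v) 1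
      (torsionH1OfDvd (W.baseChange K) (Int.natCast_dvd_natCast.mpr hdn) x))
  refine hd_iff.trans (Iff.trans ?_ hn_iff.symm)
  refine forall₂_congr fun ℓ _ ↦ forall₂_congr fun w' hw' ↦ ?_
  haveI := hw'
  letI := (adicCompletionOfLiesOver K (ringClassField K ι ℓ) v w').toAlgebra
  exact localization_torsionH1OfDvd_mem_transverseSubgroup_iff (W.baseChange K) hdn v htriv
    (w'.adicCompletion (ringClassField K ι ℓ)) x

end Global

end Summit.BirchSwinnertonDyer.BirchSwinnertonDyer.Theorems

end
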